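import Mathlib.Analysis.InnerProductSpace.Projection.Submodule
import Mathlib.Analysis.InnerProductSpace.Adjoint
import Literature.NumberTheory.Automorphic.HilbertRepSchur
import HarnessLib

/-!
# The minimal idempotent of a local type, with its range
(Gelbart, *Automorphic forms on adele groups* (1975), §10, pp. 151–153, (10.11))

Topic `NumberTheory/Automorphic`; theorems only (no definition, no named fact, no instance). Part
of the inline (D-0026) decomposition of the named fact
`Literature.NumberTheory.Automorphic.multiplicity_one_quaternionUnits K D` (`JacquetLanglandsParts`,
Gelbart Thm. 10.10), types route. `ContRepresentation.exists_minimalIdempotent`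
(`HilbertRepMinimalIdempotent`) constructs, for a unitary `R` of `Γ`, a homomorphism `j : K → Γ`,
an irreducible unitary `σ` of `K` and a unit vector `u`, the orthogonal projection `E` onto the
closed span `U` of the vectors `T u` (`T : σ → R` intertwiners) and proves its algebraic
properties, but does not export the description of its range. The cuspidal-type support theorem
(`CuspidalTypeSupport`) needs exactly that: the range of `E` must consist of `σ`-isotypic
vectors. This file restates the theorem with the range clause:

* `ContRepresentation.exists_minimalIdempotent_range` — (i)–(iv) as in
  `exists_minimalIdempotent`, and (vi) `E x = 0` whenever `⟪T u, x⟫ = 0` for all intertwiners `T`.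

## References

* S. Gelbart, *Automorphic forms on adele groups*, Ann. of Math. Studies 83 (1975), §10,
  pp. 151–153, (10.11) [Gelbart1975].
* A. Deitmar, S. Echterhoff, *Principles of harmonic analysis*, 2nd ed. (2014), Lemma 6.1.7
  [DeitmarEchterhoff2014].
-/

noncomputable section

open scoped InnerProductSpace ComplexConjugate
open Topology

namespace ContRepresentation

section MinimalIdempotentRange

variable {Γ K : Type*} [Group Γ] [Group K]
  {H : Type*} [NormedAddCommGroup H] [InnerProductSpace ℂ H] [CompleteSpace H]
  {V : Type*} [NormedAddCommGroup V] [InnerProductSpace ℂ V] [CompleteSpace V]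

/-- A closed subspace `U` stable under `A` and under `A^*` reduces `A`: the orthogonal projection
onto `U` commutes with `A` (restated, as in `HilbertRepMinimalIdempotent`). [folklore] -/
private theorem starProjection_apply_of_invariant'' (U : Submodule ℂ H) [U.HasOrthogonalProjection]
    (A : H →L[ℂ] H) (hA : ∀ v ∈ U, A v ∈ U)
    (hA' : ∀ v ∈ U, ContinuousLinearMap.adjoint A v ∈ U) (v : H) :
    U.starProjection (A v) = A (U.starProjection v) := by
  refine Submodule.eq_starProjection_of_mem_orthogonal' (hA _ (U.starProjection_apply_mem v))
    (z := A (v - U.starProjection v)) ?_ (by rw [← map_add, add_sub_cancel])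
  rw [Submodule.mem_orthogonal]
  intro w hw
  rw [← ContinuousLinearMap.adjoint_inner_left]
  exact Submodule.inner_right_of_mem_orthogonal (hA' w hw) (U.sub_starProjection_mem_orthogonal v)

/-- **The minimal idempotent attached to a vector of an irreducible unitary representation of a
subgroup, with its range** — the theorem `ContRepresentation.exists_minimalIdempotent`
(`HilbertRepMinimalIdempotent`: (i) self-adjoint idempotent `E`; (ii) `E` commutes with every
operator commuting with `R(j K)`; (iii) `E (T w) = ⟪u, w⟫ T u` for intertwiners `T : σ → R`;
(iv) `E R(j k) E = ⟪u, σ(k) u⟫ E`) with one more clause recording where `E` lives: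
(vi) **`E x = 0` for every `x` orthogonal to all `T u`**, i.e. the range of `E` is the closed span
of the vectors `T u` (so it consists of `σ`-isotypic vectors). The construction of that file is
repeated verbatim (the projection being internal to its proof) and (vi) read off it. This is the
form needed to feed the cuspidal-type support theorem `comp_map_comp_eq_of_cuspidalType`
(`CuspidalTypeSupport`), whose hypothesis is that the range of `E` consists of vectors of
cuspidal type. [cite: Gelbart1975, §10, pp. 151–153, (10.11); DeitmarEchterhoff2014, Lemma 6.1.7] -/
theorem exists_minimalIdempotent_range (R : ContRepresentation ℂ Γ H) (hR : R.IsUnitary) (j : K →* Γ)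
    (σ : ContRepresentation ℂ K V) (hσ : σ.IsUnitary) (hσirr : σ.IsTopIrreducible)
    (u : V) (hu : ‖u‖ = 1) :
    ∃ E : H →L[ℂ] H,
      (∀ x y : H, ⟪E x, y⟫_ℂ = ⟪x, E y⟫_ℂ) ∧ (∀ x, E (E x) = E x) ∧
      (∀ A : H →L[ℂ] H, (∀ k : K, A ∘L R (j k) = R (j k) ∘L A) → A ∘L E = E ∘L A) ∧
      (∀ (T : V →L[ℂ] H), (∀ k : K, T ∘L σ k = R (j k) ∘L T) →
        ∀ w : V, E (T w) = ⟪u, w⟫_ℂ • T u) ∧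
      (∀ (k : K) (y : H), E (R (j k) (E y)) = ⟪u, σ k u⟫_ℂ • E y) ∧
      (∀ x : H, (∀ (T : V →L[ℂ] H), (∀ k : K, T ∘L σ k = R (j k) ∘L T) → ⟪T u, x⟫_ℂ = 0) →
        E x = 0) := by
  -- intertwiners, the `u`-line space `U` and its projection
  set 𝒯 : Set (V →L[ℂ] H) := {T | ∀ k : K, T ∘L σ k = R (j k) ∘L T} with h𝒯
  set S₀ : Set H := {x | ∃ T ∈ 𝒯, x = T u} with hS₀
  set U : Submodule ℂ H := (Submodule.span ℂ S₀).topologicalClosure with hUdef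
  have hUc : IsClosed (U : Set H) := Submodule.isClosed_topologicalClosure _
  haveI : CompleteSpace U := hUc.completeSpace_coe
  have hS₀U : S₀ ⊆ (U : Set H) := fun x hx =>
    Submodule.le_topologicalClosure _ (Submodule.subset_span hx)
  have huu : ⟪u, u⟫_ℂ = 1 := by
    rw [inner_self_eq_norm_sq_to_K, hu]; norm_num
  -- adjoints of intertwiners intertwine back
  have hadjT : ∀ T ∈ 𝒯, ∀ k : K,
      ContinuousLinearMap.adjoint T ∘L R (j k) = σ k ∘L ContinuousLinearMap.adjoint T := by
    intro T hT k
    have h := congrArg ContinuousLinearMap.adjoint (hT k⁻¹)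
    rw [ContinuousLinearMap.adjoint_comp, ContinuousLinearMap.adjoint_comp, hσ.adjoint_apply,
      hR.adjoint_apply, map_inv j, inv_inv, inv_inv] at h
    exact h.symm
  -- Schur: `T'^* T` is a scalar, hence `T w' ⟂ T' u` for `w' ⟂ u`
  have horthT : ∀ T ∈ 𝒯, ∀ T' ∈ 𝒯, ∀ w' : V, ⟪u, w'⟫_ℂ = 0 → ⟪T' u, T w'⟫_ℂ = 0 := by
    intro T hT T' hT' w' hw'
    set D : V →L[ℂ] V := ContinuousLinearMap.adjoint T' ∘L T with hD
    have hDcomm : ∀ k : K, Commute (σ k : V →L[ℂ] V) D := by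
      intro k
      change σ k * D = D * σ k
      rw [hD, ContinuousLinearMap.mul_def, ContinuousLinearMap.mul_def,
        ← ContinuousLinearMap.comp_assoc, ← hadjT T' hT' k, ContinuousLinearMap.comp_assoc,
        ← hT k, ContinuousLinearMap.comp_assoc]
    obtain ⟨c, hc⟩ := hσirr.exists_apply_eq_smul_of_commute hσ hDcomm
    rw [← ContinuousLinearMap.adjoint_inner_right, ← ContinuousLinearMap.comp_apply, ← hD, hc,
      inner_smul_right, hw', mul_zero]
  -- (iii) `E (T w) = ⟪u, w⟫ T u`
  have hiii : ∀ T ∈ 𝒯, ∀ w : V, U.starProjection (T w) = ⟪u, w⟫_ℂ • T u := by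
    intro T hT w
    set w' : V := w - ⟪u, w⟫_ℂ • u with hw'
    have hw'u : ⟪u, w'⟫_ℂ = 0 := by
      rw [hw', inner_sub_right, inner_smul_right, huu, mul_one, sub_self]
    have hdecomp : T w = ⟪u, w⟫_ℂ • T u + T w' := by
      rw [hw', map_sub, map_smul, add_sub_cancel]
    have hTu : U.starProjection (T u) = T u :=
      Submodule.starProjection_eq_self_iff.mpr (hS₀U ⟨T, hT, rfl⟩)
    have hTw' : U.starProjection (T w') = 0 := by
      rw [Submodule.starProjection_apply_eq_zero_iff]
      -- `T w' ∈ Uᗮ`: `U ≤ (ℂ ∙ T w')ᗮ`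
      have hle : U ≤ (ℂ ∙ T w')ᗮ := by
        refine (Submodule.span ℂ S₀).topologicalClosure_minimal ?_ (Submodule.isClosed_orthogonal _)
        rw [Submodule.span_le]
        rintro _ ⟨T', hT', rfl⟩
        rw [SetLike.mem_coe, Submodule.mem_orthogonal_singleton_iff_inner_left]
        exact horthT T hT T' hT' w' hw'u
      rw [Submodule.mem_orthogonal]
      intro x hx
      have hx' := hle hx
      rw [Submodule.mem_orthogonal_singleton_iff_inner_left] at hx'
      exact hx'
    rw [hdecomp, map_add, map_smul, hTu, hTw', add_zero]
  -- (ii) operators commuting with `R(j K)` reduce `U`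
  have hii : ∀ A : H →L[ℂ] H, (∀ k : K, A ∘L R (j k) = R (j k) ∘L A) →
      A ∘L U.starProjection = U.starProjection ∘L A := by
    intro A hA
    -- `A` and `A^*` commute with `R(j K)`
    have hA' : ∀ k : K, ContinuousLinearMap.adjoint A ∘L R (j k) =
        R (j k) ∘L ContinuousLinearMap.adjoint A := by
      intro k
      have h := congrArg ContinuousLinearMap.adjoint (hA k⁻¹)
      rw [ContinuousLinearMap.adjoint_comp, ContinuousLinearMap.adjoint_comp, hR.adjoint_apply,
        map_inv j, inv_inv] at h
      exact h.symm
    -- both map `U` into `U`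
    have hmapsU : ∀ C : H →L[ℂ] H, (∀ k : K, C ∘L R (j k) = R (j k) ∘L C) → ∀ v ∈ U, C v ∈ U := by
      intro C hC
      have hCS₀ : ∀ x ∈ S₀, C x ∈ S₀ := by
        rintro _ ⟨T, hT, rfl⟩
        refine ⟨C ∘L T, fun k => ?_, rfl⟩
        rw [ContinuousLinearMap.comp_assoc, hT k, ← ContinuousLinearMap.comp_assoc, hC k,
          ContinuousLinearMap.comp_assoc]
      have hCspan : ∀ x ∈ Submodule.span ℂ S₀, C x ∈ Submodule.span ℂ S₀ := by
        intro x hx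
        have h : (Submodule.span ℂ S₀).map (C : H →ₗ[ℂ] H) ≤ Submodule.span ℂ S₀ := by
          rw [Submodule.map_span]
          refine Submodule.span_mono ?_
          rintro _ ⟨y, hy, rfl⟩
          exact hCS₀ y hy
        exact h ⟨x, hx, rfl⟩
      intro v hv
      have hmaps : Set.MapsTo C (Submodule.span ℂ S₀ : Set H) (Submodule.span ℂ S₀ : Set H) :=
        fun y hy => hCspan y hy
      have hcl := hmaps.closure C.continuous
      rw [← Submodule.topologicalClosure_coe] at hcl
      exact hcl hv
    apply ContinuousLinearMap.ext
    intro v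
    simp only [ContinuousLinearMap.coe_comp, Function.comp_apply]
    exact (starProjection_apply_of_invariant'' U A (hmapsU A hA) (hmapsU _ hA') v).symm
  -- (iv) `E R(j k) E = ⟪u, σ k u⟫ E`
  have hiv : ∀ (k : K) (y : H), U.starProjection (R (j k) (U.starProjection y)) =
      ⟪u, σ k u⟫_ℂ • U.starProjection y := by
    intro k y
    -- the bounded operator `x ↦ E (R(j k) x) - c • x` vanishes on `S₀`, hence on `U`
    set Φ : H →L[ℂ] H := U.starProjection ∘L R (j k) - ⟪u, σ k u⟫_ℂ • ContinuousLinearMap.id ℂ H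
      with hΦ
    have hΦapply : ∀ x, Φ x = U.starProjection (R (j k) x) - ⟪u, σ k u⟫_ℂ • x := fun x => rfl
    have hΦS₀ : ∀ x ∈ S₀, Φ x = 0 := by
      rintro _ ⟨T, hT, rfl⟩
      have h1 : R (j k) (T u) = T (σ k u) := by
        rw [← ContinuousLinearMap.comp_apply, ← hT k, ContinuousLinearMap.comp_apply]
      rw [hΦapply, h1, hiii T hT (σ k u), sub_self]
    have hΦU : ∀ x ∈ U, Φ x = 0 := by
      intro x hx
      have hle : U ≤ LinearMap.ker (Φ : H →ₗ[ℂ] H) := by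
        refine (Submodule.span ℂ S₀).topologicalClosure_minimal ?_ (Φ.isClosed_ker)
        rw [Submodule.span_le]
        intro x hx
        exact hΦS₀ x hx
      exact hle hx
    have h := hΦU _ (U.starProjection_apply_mem y)
    rw [hΦapply, sub_eq_zero] at h
    exact h
  -- (vi) `E` kills the vectors orthogonal to all `T u`
  have hvi : ∀ x : H, (∀ (T : V →L[ℂ] H), (∀ k : K, T ∘L σ k = R (j k) ∘L T) → ⟪T u, x⟫_ℂ = 0) →
      U.starProjection x = 0 := by
    intro x hx
    rw [Submodule.starProjection_apply_eq_zero_iff, Submodule.mem_orthogonal]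
    intro y hy
    have hle : U ≤ (ℂ ∙ x)ᗮ := by
      refine (Submodule.span ℂ S₀).topologicalClosure_minimal ?_ (Submodule.isClosed_orthogonal _)
      rw [Submodule.span_le]
      rintro _ ⟨T, hT, rfl⟩
      rw [SetLike.mem_coe, Submodule.mem_orthogonal_singleton_iff_inner_left]
      exact hx T hT
    have hy' := hle hy
    rw [Submodule.mem_orthogonal_singleton_iff_inner_left] at hy'
    exact hy'
  refine ⟨U.starProjection, fun x y => Submodule.inner_starProjection_left_eq_right U x y,
    fun x => ?_, fun A hA => hii A hA, fun T hT w => hiii T hT w, hiv, hvi⟩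
  exact Submodule.starProjection_eq_self_iff.mpr (U.starProjection_apply_mem x)


end MinimalIdempotentRange

end ContRepresentation
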